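import Literature.MathematicalPhysics.QuantumLattice.KomaTasakiGriffithsTheoremSU2Proofs
import HarnessLib

/-!
# Koma–Tasaki 1993, Theorem 2.1 WITHOUT the free-energy hypothesis i): along a subsequence the
# free energies always converge, so long-range order of the symmetric Gibbs states forces the
# order parameter under every symmetry-breaking field `B > 0` — eventually along the FULL sequence

T. Koma, H. Tasaki, *Symmetry breaking in Heisenberg antiferromagnets*, Commun. Math. Phys. **158**
(1993) 191–214 [KomaTasaki1993] (held: `paper:doi-10-1007-bf02097237`, read at pp. 195–197, 206),
§2 Theorem 2.1 (2.13) with hypotheses i) (2.10), ii), iii) (p. 196), proved in the tree as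
`KomaTasaki.kt93_theorem_2_1_holds` (`KomaTasakiGriffithsTheoremProofs.lean`) in the form (2.13′):
for a sequence of `ℤ₂` systems `sys j` (`KomaTasaki.Z2System`, `KomaTasakiGriffithsTheorem.lean`) with
uniform constants `h̄, ō, r`, `N_j → ∞`, a fixed `β > 0` and HYPOTHESIS i) — for every real `B` the free
energies per site `f_j(B) = -(βN_j)⁻¹ log Tr e^{-β(H_j - B O_j)}` converge — one has, for every `k ≥ 1`,
`B > 0`, `ε > 0`, eventually in `(j, j')`: `(N_{j'}^{-2k}⟨O^{2k}⟩_{j'}(0))^{1/(2k)} ≤ N_j⁻¹⟨O⟩_j(B) + ε`.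

KT93 p. 196 on the long-range order parameter: "The limit may not exist in general, but one can always
take a subsequence so that it exists."  The same is true of hypothesis i), and this file records the
consequence, which removes i) from the consumable direction "LRO ⟹ order parameter":

* §1 (one finite system, PROVED): the free energy per site is `ō`-Lipschitz in the field,
  `|f_Λ(B) - f_Λ(B')| ≤ ō|B - B'|` (`Z2System.abs_freeEnergy_sub_freeEnergy_le`; `log Z` is
  `β‖·‖`-Lipschitz, tree `abs_log_partitionFn_sub_log_partitionFn_le`, and `‖O_Λ‖ ≤ Nō`), and a priori
  bounded, `|f_Λ(B)| ≤ (βN)⁻¹ log dim 𝓗_Λ + h̄ + |B|ō` (`Z2System.abs_freeEnergy_le`).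
* §2 (PROVED) **`Z2System.exists_strictMono_forall_tendsto_freeEnergy`**: for ANY sequence of `ℤ₂`
  systems with uniform constants and `log dim 𝓗_j ≤ c·N_j` (lattice fermions: `dim = 4^{N}`; spins
  `S`: `(2S+1)^N`) there is a subsequence `φ` along which `f_{φ(j)}(B)` converges for EVERY real `B`
  simultaneously — Cantor–Tychonoff diagonal extraction on the rational fields (`isCompact_univ_pi`,
  `IsCompact.tendsto_subseq` in the first-countable product `ℚ → ℝ`) and the uniform Lipschitz bound
  of §1 to pass from `ℚ` to `ℝ` (a Cauchy / `3ε` argument).  This is the Helly–Arzelà–Ascoli selection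
  for the equi-Lipschitz concave functions `f_j`. [cite: BratteliRobinsonI1987, Thm. 2.3.15 and §4.3.1]
* §3 (PROVED, KT93 Thm 2.1 BY NAME along the extracted subsequence):
  **`kt93_theorem_2_1_subseq`** — hypotheses ii), iii), `N_j → ∞`, `log dim ≤ cN`, NO hypothesis i):
  there is a subsequence `φ` along which the conclusion (2.13′) of Theorem 2.1 holds (both indices in
  the subsequence);
  **`le_magnetisation_add_of_eventually_moment`** — the FULL-SEQUENCE floor: if the symmetric Gibbs
  states carry long-range order eventually along the full sequence, `σ^{2k} ≤ N_j^{-2k}⟨O^{2k}⟩_j(0)`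
  for all large `j` (`σ ≥ 0`, `k ≥ 1`), then for every `B > 0` and `ε > 0`, eventually along the FULL
  sequence `N_j⁻¹⟨O⟩_j(B) ≥ σ - ε` (by contradiction: a violating subsequence has a sub-subsequence with
  convergent free energies, along which Theorem 2.1 and the inherited long-range order contradict the
  violation); `k = 1` spelling `le_magnetisation_add_of_eventually_moment_one` (`σ² ≤ N⁻²⟨O²⟩(0)`).
  So `liminf_Λ N⁻¹⟨O_Λ⟩_Λ(B) ≥ σ` for every `B > 0` — hence `m_s ≥ σ` for every infinitesimal-field
  limit point — WITHOUT assuming that the thermodynamic limit of the free energy exists.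

* §4 (PROVED, the `U(1)` factor `√2`): **`le_sqrt_two_mul_magnetisation_add_of_eventually_moment_one_u1`** —
  the same full-sequence floor with `√2 σ` in place of `σ` for systems carrying a second Hermitian order component
  `O^{(2)}` and a conserved generator `C` rotating `(O^{(1)}, O^{(2)})` (`[C, O^{(2)}] = ε O^{(1)}`,
  `[C, O^{(1)}] = -ε O^{(2)}`, `‖[O^{(2)}, O^{(1)}]‖ ≤ κ ō² N`; for pairing `C = N̂/2`), from the tree's
  `Z2System.kt93_corollary_2_2_u1` (KT93 Remark after Theorem 6.1: "the models with an `SO(2) = U(1)`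
  invariance, where we get a factor `√2`") along the extracted subsequence — again NO hypothesis i).
* §5 (PROVED, the `SU(2)` factor `√3`, KT93 Corollary 2.2 BY NAME):
  **`SU2System.le_sqrt_three_mul_magnetisation_add_of_eventually_moment_one`** — for a sequence of KT93
  `SU(2)` systems (`KomaTasaki.SU2System`, hypotheses ii)–vi)) with `N_j → ∞`, `log dim ≤ cN`, `β > 0`: eventual
  long-range order `σ² ≤ N_j⁻²⟨(O^{(1)}_j)²⟩_j(0)` forces, for every `B > 0`, `ε > 0`, eventually along the FULL
  sequence `√3 σ ≤ N_j⁻¹⟨O^{(1)}_j⟩_j(B) + ε`, from the tree's `kt93_corollary_2_2_holds` along the extracted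
  subsequence — NO hypothesis i).

What is NOT obtained without i) (and is not claimed): the comparison of moments along one subsequence
with magnetisations along an unrelated one (the two volume limits in (2.13′) for the full sequence), since
free-energy limits along different subsequences may differ.  Direction LRO ⟹ response only (the converse
is not asserted, cf. `Literature.Barriers.HubbardSuperconductivity.SourcedOrderWithoutGroundStateLRO`).
No definition, no named fact; everything is proved from the tree's `kt93_theorem_2_1_holds`.

## Mathlib / tree search

REUSED: `KomaTasaki.Z2System` (+ `freeEnergy`, `magnetisation`, `moment`, `norm_order_le`,
`norm_hamiltonian_le`, `isHermitian_fieldHamiltonian`), `kt93_theorem_2_1_holds`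
(`KomaTasakiGriffithsTheorem(Proofs)`), `Z2System.kt93_corollary_2_2_u1` (`KomaTasakiGriffithsTheoremSU2Proofs`), `abs_log_partitionFn_sub_log_partitionFn_le`
(`ApproximatingHamiltonianProofs`).  Mathlib: `isCompact_univ_pi`, `isCompact_closedBall`,
`IsCompact.tendsto_subseq`, `tendsto_pi_nhds`, `Filter.extraction_of_frequently_atTop`,
`cauchySeq_tendsto_of_complete`, `Metric.cauchySeq_iff`, `exists_rat_btwn`, `Real.pow_rpow_inv_natCast`.
`lean search 'kt93|freeEnergy.*subseq|tendsto_subseq.*freeEnergy'` (2026-08-29): the tree's consumers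
(`DWaveKomaTasakiThermal.dWave_kt93_theorem_2_1`, `…TTPrime`) all carry hypothesis i) as an explicit
assumption `hlim`; no subsequence form exists.

## References

* [KomaTasaki1993] T. Koma, H. Tasaki, Commun. Math. Phys. 158 (1993) 191–214, §2 (2.6)–(2.13), i)–iii),
  Theorem 2.1; p. 196 ("one can always take a subsequence"); §4 (4.5)–(4.7), §5.
* [BratteliRobinsonI1987] O. Bratteli, D. W. Robinson, *OAQSM 1*, 2nd ed., Thm. 2.3.15 (weak-⋆ compactness),
  §4.3.1 (limit points of finite-volume states).
* [DysonLiebSimon1978] F. J. Dyson, E. H. Lieb, B. Simon, J. Stat. Phys. 18 (1978) 335, Thm. 1.2 (the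
  commuting case of the LRO ⟹ spontaneous-magnetisation step).
-/

noncomputable section

open scoped Matrix.Norms.L2Operator ComplexOrder Topology
open Matrix Filter Finset

namespace Literature.MathematicalPhysics.QuantumLattice.KomaTasaki

universe v

namespace Z2System

/-! ### §1. One finite system: the free energy per site is `ō`-Lipschitz in the field and bounded -/

section Finite

variable {N : ℕ} {hb ob : ℝ} {r : ℕ} {n : Type v} [Fintype n] [DecidableEq n]
variable (sys : Z2System N hb ob r n)

/-- `H_Λ(B) - H_Λ(B') = (B' - B) O_Λ`. [cite: KomaTasaki1993, (2.6)] -/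
theorem fieldHamiltonian_sub_fieldHamiltonian (B B' : ℝ) :
    sys.fieldHamiltonian B - sys.fieldHamiltonian B' = ((B' - B : ℝ) : ℂ) • sys.order := by
  simp only [fieldHamiltonian, Complex.ofReal_sub, sub_smul]
  abel

/-- `‖H_Λ(B) - H_Λ(B')‖ ≤ |B - B'| · Nō`. [cite: KomaTasaki1993, (2.6) and hypothesis ii)] -/
theorem norm_fieldHamiltonian_sub_le (B B' : ℝ) :
    ‖sys.fieldHamiltonian B - sys.fieldHamiltonian B'‖ ≤ |B - B'| * (N * ob) := by
  rw [fieldHamiltonian_sub_fieldHamiltonian, norm_smul, Complex.norm_real, Real.norm_eq_abs, abs_sub_comm]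
  exact mul_le_mul_of_nonneg_left sys.norm_order_le (abs_nonneg _)

/-- **The free energy per site is `ō`-Lipschitz in the field**: `|f_Λ(B) - f_Λ(B')| ≤ ō |B - B'|`
(`β > 0`; `log Z` is `β‖·‖`-Lipschitz and `‖O_Λ‖ ≤ Nō`; equivalently `|∂f_Λ/∂B| = |N⁻¹⟨O_Λ⟩_Λ(B)| ≤ ō`).
[cite: KomaTasaki1993, (2.8)–(2.9) and hypothesis ii)] -/
theorem abs_freeEnergy_sub_freeEnergy_le [Nonempty n] (hob : 0 ≤ ob) {β : ℝ} (hβ : 0 < β) (B B' : ℝ) :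
    |sys.freeEnergy β B - sys.freeEnergy β B'| ≤ ob * |B - B'| := by
  unfold freeEnergy
  rcases Nat.eq_zero_or_pos N with hN | hN
  · subst hN
    have h0 : (β * ((0 : ℕ) : ℝ))⁻¹ = 0 := by simp
    rw [h0, neg_zero, zero_mul, zero_mul, sub_self, abs_zero]
    exact mul_nonneg hob (abs_nonneg _)
  · have hN' : (0 : ℝ) < N := Nat.cast_pos.mpr hN
    have hβN : 0 < β * N := mul_pos hβ hN'
    have hlog := abs_log_partitionFn_sub_log_partitionFn_le (sys.isHermitian_fieldHamiltonian B)
      (sys.isHermitian_fieldHamiltonian B') hβ.le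
    have hH := sys.norm_fieldHamiltonian_sub_le B B'
    set LB := Real.log (partitionFn β (sys.fieldHamiltonian B)).re
    set LB' := Real.log (partitionFn β (sys.fieldHamiltonian B')).re
    have h1 : |LB - LB'| ≤ β * (|B - B'| * (N * ob)) :=
      hlog.trans (mul_le_mul_of_nonneg_left hH hβ.le)
    have h2 : -(β * ↑N)⁻¹ * LB - -(β * ↑N)⁻¹ * LB' = -((β * ↑N)⁻¹ * (LB - LB')) := by ring
    rw [h2, abs_neg, abs_mul, abs_inv, abs_of_pos hβN]
    calc (β * ↑N)⁻¹ * |LB - LB'| ≤ (β * ↑N)⁻¹ * (β * (|B - B'| * (N * ob))) :=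
          mul_le_mul_of_nonneg_left h1 (inv_nonneg.mpr hβN.le)
      _ = ob * |B - B'| := by field_simp

/-- `Z_β(0) = dim` (the partition function of the zero Hamiltonian is the dimension). [folklore] -/
private theorem partitionFn_zero_hamiltonian (β : ℝ) : partitionFn β (0 : Matrix n n ℂ) = Fintype.card n := by
  simp [partitionFn, gibbsWeight, NormedSpace.exp_zero, Matrix.trace_one]

/-- `|log Z_β(H)  - log dim| ≤ β‖H‖` for Hermitian `H` and `β ≥ 0`. [folklore] -/
private theorem abs_log_partitionFn_sub_log_card_le [Nonempty n] {H : Matrix n n ℂ} (hH : H.IsHermitian) {β : ℝ}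
    (hβ : 0 ≤ β) : |Real.log (partitionFn β H).re - Real.log (Fintype.card n)| ≤ β * ‖H‖ := by
  have h := abs_log_partitionFn_sub_log_partitionFn_le hH (isHermitian_zero : (0 : Matrix n n ℂ).IsHermitian) hβ
  rw [partitionFn_zero_hamiltonian, sub_zero] at h
  have hre : ((Fintype.card n : ℂ)).re = (Fintype.card n : ℝ) := by simp
  rwa [hre] at h

/-- **A priori bound on the free energy per site**: `|f_Λ(B)| ≤ (βN)⁻¹ log dim 𝓗_Λ + h̄ + |B| ō`
(`β > 0`, `N ≥ 1`; `|log Z_β(H_Λ(B)) - log dim| ≤ β‖H_Λ(B)‖ ≤ βN(h̄ + |B|ō)`).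
[cite: KomaTasaki1993, (2.8) and hypothesis ii), (3.1)] -/
theorem abs_freeEnergy_le [Nonempty n] {β : ℝ} (hβ : 0 < β) (hN : 0 < N) (B : ℝ) :
    |sys.freeEnergy β B| ≤ Real.log (Fintype.card n) / (β * N) + (hb + |B| * ob) := by
  unfold freeEnergy
  have hN' : (0 : ℝ) < N := Nat.cast_pos.mpr hN
  have hβN : 0 < β * N := mul_pos hβ hN'
  have hlog := abs_log_partitionFn_sub_log_card_le (sys.isHermitian_fieldHamiltonian B) hβ.le
  have hH : ‖sys.fieldHamiltonian B‖ ≤ N * hb + |B| * (N * ob) := by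
    unfold fieldHamiltonian
    refine (norm_sub_le _ _).trans (add_le_add sys.norm_hamiltonian_le ?_)
    rw [norm_smul, Complex.norm_real, Real.norm_eq_abs]
    exact mul_le_mul_of_nonneg_left sys.norm_order_le (abs_nonneg _)
  have hcard : 0 ≤ Real.log (Fintype.card n) := Real.log_nonneg (by exact_mod_cast Fintype.card_pos)
  set L := Real.log (partitionFn β (sys.fieldHamiltonian B)).re
  set D := Real.log (Fintype.card n : ℝ)
  have h1 : |L| ≤ D + β * (N * hb + |B| * (N * ob)) := by
    have := abs_sub_abs_le_abs_sub L D
    rw [abs_of_nonneg hcard] at this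
    nlinarith [hlog, mul_le_mul_of_nonneg_left hH hβ.le]
  rw [abs_mul, abs_neg, abs_inv, abs_of_pos hβN]
  calc (β * ↑N)⁻¹ * |L| ≤ (β * ↑N)⁻¹ * (D + β * (N * hb + |B| * (N * ob))) :=
        mul_le_mul_of_nonneg_left h1 (inv_nonneg.mpr hβN.le)
    _ = D / (β * N) + (hb + |B| * ob) := by field_simp

/-- A bound uniform in the volume: if `log dim 𝓗_Λ ≤ c N` then `|f_Λ(B)| ≤ |c|/β + |h̄| + |B| ō` (also for
`N = 0`, where `f_Λ = 0`). [cite: KomaTasaki1993, (2.8) and hypothesis ii)] -/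
theorem abs_freeEnergy_le_of_log_card_le [Nonempty n] (hob : 0 ≤ ob) {β : ℝ} (hβ : 0 < β) {c : ℝ}
    (hdim : Real.log (Fintype.card n) ≤ c * N) (B : ℝ) :
    |sys.freeEnergy β B| ≤ |c| / β + (|hb| + |B| * ob) := by
  rcases Nat.eq_zero_or_pos N with hN | hN
  · have h0 : sys.freeEnergy β B = 0 := by simp [freeEnergy, hN]
    rw [h0, abs_zero]
    positivity
  · have hN' : (0 : ℝ) < N := Nat.cast_pos.mpr hN
    refine (sys.abs_freeEnergy_le hβ hN B).trans (add_le_add ?_ (add_le_add (le_abs_self _) le_rfl))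
    rw [div_le_div_iff₀ (mul_pos hβ hN') hβ]
    calc Real.log (Fintype.card n) * β ≤ c * N * β := mul_le_mul_of_nonneg_right hdim hβ.le
      _ ≤ |c| * N * β := by gcongr; exact le_abs_self c
      _ = |c| * (β * N) := by ring

end Finite

/-! ### §2. A sequence of systems: a subsequence along which ALL free energies converge -/

section Sequence

variable {hb ob : ℝ} {r : ℕ} {Ns : ℕ → ℕ} {ns : ℕ → Type v} [∀ j, Fintype (ns j)] [∀ j, DecidableEq (ns j)]
  [∀ j, Nonempty (ns j)]

/-- **Diagonal extraction of convergent free energies.**  For every sequence of `ℤ₂` systems with uniform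
constants `h̄, ō, r`, a fixed `β > 0`, and Hilbert-space dimensions with `log dim 𝓗_j ≤ c N_j`, there is a
subsequence `φ` along which, for EVERY real field `B`, the free energies per site `f_{φ(j)}(B)` converge
(KT93's hypothesis i) holds along `φ`).  Cantor–Tychonoff on the rational fields + the uniform
`ō`-Lipschitz bound. [cite: KomaTasaki1993, §2 i) (2.10) and p. 196 (subsequences)]
[cite: BratteliRobinsonI1987, Thm. 2.3.15 and §4.3.1] -/
theorem exists_strictMono_forall_tendsto_freeEnergy (sys : (j : ℕ) → Z2System (Ns j) hb ob r (ns j))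
    (hob : 0 ≤ ob) {β : ℝ} (hβ : 0 < β) {c : ℝ} (hdim : ∀ j, Real.log (Fintype.card (ns j)) ≤ c * Ns j) :
    ∃ φ : ℕ → ℕ, StrictMono φ ∧
      ∀ B : ℝ, ∃ f : ℝ, Tendsto (fun j => (sys (φ j)).freeEnergy β B) atTop (𝓝 f) := by
  -- uniform bound at each field
  let M : ℚ → ℝ := fun q => |c| / β + (|hb| + |(q : ℝ)| * ob)
  -- rational coordinates
  let x : ℕ → ℚ → ℝ := fun j q => (sys j).freeEnergy β q
  have hK : IsCompact (Set.pi Set.univ fun q : ℚ => Metric.closedBall (0 : ℝ) (M q)) :=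
    isCompact_univ_pi fun q => isCompact_closedBall (0 : ℝ) (M q)
  have hx : ∀ j, x j ∈ Set.pi Set.univ fun q : ℚ => Metric.closedBall (0 : ℝ) (M q) := fun j q _ => by
    rw [Metric.mem_closedBall, dist_zero_right, Real.norm_eq_abs]
    exact (sys j).abs_freeEnergy_le_of_log_card_le hob hβ (hdim j) q
  obtain ⟨g, -, φ, hφ, hg⟩ := hK.tendsto_subseq hx
  have hcoord : ∀ q : ℚ, Tendsto (fun j => x (φ j) q) atTop (𝓝 (g q)) := fun q => tendsto_pi_nhds.1 hg q
  refine ⟨φ, hφ, fun B => ?_⟩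
  -- the real field `B`: the sequence is Cauchy by the `3ε` argument through a nearby rational
  let u : ℕ → ℝ := fun j => (sys (φ j)).freeEnergy β B
  suffices hC : CauchySeq u from cauchySeq_tendsto_of_complete hC
  rw [Metric.cauchySeq_iff]
  intro ε hε
  -- a rational `q` with `ō |B - q| < ε/3`
  have hδ : 0 < ε / (3 * (ob + 1)) := div_pos hε (by positivity)
  obtain ⟨q, hq1, hq2⟩ := exists_rat_btwn (show B - ε / (3 * (ob + 1)) < B + ε / (3 * (ob + 1)) by linarith)
  have hBq : |B - (q : ℝ)| < ε / (3 * (ob + 1)) := by rw [abs_lt]; constructor <;> linarith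
  have hLip : ∀ j, |u j - x (φ j) q| ≤ ob * |B - (q : ℝ)| := fun j =>
    (sys (φ j)).abs_freeEnergy_sub_freeEnergy_le hob hβ B q
  have hthird : ob * |B - (q : ℝ)| < ε / 3 := by
    calc ob * |B - (q : ℝ)| ≤ ob * (ε / (3 * (ob + 1))) := mul_le_mul_of_nonneg_left hBq.le hob
      _ < ε / 3 := by
          rw [mul_div_assoc', div_lt_div_iff₀ (by positivity) (by norm_num)]
          nlinarith
  -- the `q`-coordinate is Cauchy
  have hCq : CauchySeq fun j => x (φ j) q := (hcoord q).cauchySeq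
  rw [Metric.cauchySeq_iff] at hCq
  obtain ⟨J, hJ⟩ := hCq (ε / 3) (by positivity)
  refine ⟨J, fun m hm k hk => ?_⟩
  have h1 := hLip m
  have h2 := hLip k
  have h3 := hJ m hm k hk
  rw [Real.dist_eq] at h3 ⊢
  calc |u m - u k| = |(u m - x (φ m) q) + (x (φ m) q - x (φ k) q) - (u k - x (φ k) q)| := by ring_nf
    _ ≤ |u m - x (φ m) q| + |x (φ m) q - x (φ k) q| + |u k - x (φ k) q| := by
        have ha := abs_add_le (u m - x (φ m) q) (x (φ m) q - x (φ k) q)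
        have hs := abs_sub (u m - x (φ m) q + (x (φ m) q - x (φ k) q)) (u k - x (φ k) q)
        linarith
    _ < ε / 3 + ε / 3 + ε / 3 := by linarith
    _ = ε := by ring

/-! ### §3. KT93 Theorem 2.1 without hypothesis i) -/

/-- **KOMA–TASAKI 1993 THEOREM 2.1 ALONG A SUBSEQUENCE, WITHOUT HYPOTHESIS i).**  For every sequence
of `ℤ₂` systems `sys j` with uniform constants `h̄, ō, r` (ii), iii)), `N_j → ∞`, Hilbert-space
dimensions with `log dim 𝓗_j ≤ c N_j`, and every `β > 0`, there is a subsequence `φ` such that for every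
`k ≥ 1`, `B > 0`, `ε > 0` there is `j₀` with, for all `j, j' ≥ j₀`,
`(N_{φ j'}^{-2k} ⟨O^{2k}⟩_{φ j'}(0))^{1/(2k)} ≤ N_{φ j}⁻¹ ⟨O⟩_{φ j}(B) + ε`
— the conclusion (2.13′) of Theorem 2.1 for the sequence `sys ∘ φ` (whose free energies converge for
every field by `exists_strictMono_forall_tendsto_freeEnergy`, so that the tree's
`kt93_theorem_2_1_holds` applies to it by name).
[cite: KomaTasaki1993, Theorem 2.1 (2.13) with §2 i)–iii); p. 196 (subsequences)] -/
theorem kt93_theorem_2_1_subseq (sys : (j : ℕ) → Z2System (Ns j) hb ob r (ns j)) (hob : 0 ≤ ob)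
    {β : ℝ} (hβ : 0 < β) (hN : Tendsto Ns atTop atTop) {c : ℝ}
    (hdim : ∀ j, Real.log (Fintype.card (ns j)) ≤ c * Ns j) :
    ∃ φ : ℕ → ℕ, StrictMono φ ∧
      ∀ k : ℕ, 1 ≤ k → ∀ B : ℝ, 0 < B → ∀ ε : ℝ, 0 < ε →
        ∃ j₀ : ℕ, ∀ j j' : ℕ, j₀ ≤ j → j₀ ≤ j' →
          ((sys (φ j')).moment β k) ^ ((1 : ℝ) / (2 * k)) ≤ (sys (φ j)).magnetisation β B + ε := by
  obtain ⟨φ, hφ, hlim⟩ := exists_strictMono_forall_tendsto_freeEnergy sys hob hβ hdim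
  exact ⟨φ, hφ, kt93_theorem_2_1_holds hb ob r (Ns ∘ φ) (fun j => ns (φ j)) (fun j => sys (φ j)) β hβ
    (hN.comp hφ.tendsto_atTop) hlim⟩

/-- `(σ^{2k})^{1/(2k)} = σ` for `σ ≥ 0`, `k ≥ 1`, with the exponent spelled `1/(2k)` as in
`kt93_theorem_2_1`. [folklore] -/
private theorem pow_rpow_one_div_two_mul {σ : ℝ} (hσ : 0 ≤ σ) {k : ℕ} (hk : 1 ≤ k) :
    (σ ^ (2 * k)) ^ ((1 : ℝ) / (2 * k)) = σ := by
  have h : ((1 : ℝ) / (2 * k)) = ((2 * k : ℕ) : ℝ)⁻¹ := by push_cast; rw [one_div]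
  rw [h]
  exact Real.pow_rpow_inv_natCast hσ (by omega)

/-- **LONG-RANGE ORDER ALONG THE FULL SEQUENCE FORCES THE ORDER PARAMETER ALONG THE FULL SEQUENCE, AT
EVERY FIELD `B > 0`, WITHOUT HYPOTHESIS i).**  For a sequence of `ℤ₂` systems with uniform constants,
`N_j → ∞`, `log dim 𝓗_j ≤ c N_j`, `β > 0`, `k ≥ 1`, `σ ≥ 0`: if eventually `σ^{2k} ≤ N_j^{-2k}⟨O^{2k}⟩_j(0)`
(long-range order of the symmetric Gibbs states), then for every `B > 0` and `ε > 0`, eventually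
`σ ≤ N_j⁻¹⟨O⟩_j(B) + ε`; i.e. `liminf_Λ N⁻¹⟨O_Λ⟩_Λ(B) ≥ σ` for every `B > 0`, hence `m_s ≥ σ` for every
infinitesimal-field limit point.  Proof: a violating subsequence has, by `kt93_theorem_2_1_subseq`, a
sub-subsequence along which Theorem 2.1 holds; the long-range order is inherited by it — contradiction.
[cite: KomaTasaki1993, Theorem 2.1 (2.13), (2.11)–(2.12); p. 196 (subsequences)] -/
theorem le_magnetisation_add_of_eventually_moment (sys : (j : ℕ) → Z2System (Ns j) hb ob r (ns j))
    (hob : 0 ≤ ob) {β : ℝ} (hβ : 0 < β) (hN : Tendsto Ns atTop atTop) {c : ℝ}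
    (hdim : ∀ j, Real.log (Fintype.card (ns j)) ≤ c * Ns j) {k : ℕ} (hk : 1 ≤ k) {σ : ℝ} (hσ : 0 ≤ σ)
    (hLRO : ∀ᶠ j in atTop, σ ^ (2 * k) ≤ (sys j).moment β k) {B : ℝ} (hB : 0 < B) {ε : ℝ} (hε : 0 < ε) :
    ∀ᶠ j in atTop, σ ≤ (sys j).magnetisation β B + ε := by
  by_contra hcon
  rw [not_eventually] at hcon
  obtain ⟨ψ, hψ, hbad⟩ := extraction_of_frequently_atTop hcon
  obtain ⟨φ, hφ, hkt⟩ := kt93_theorem_2_1_subseq (fun i => sys (ψ i)) hob hβ (hN.comp hψ.tendsto_atTop)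
    (fun i => hdim (ψ i))
  obtain ⟨j₀, hj₀⟩ := hkt k hk B hB (ε / 2) (half_pos hε)
  have hψφ : Tendsto (fun j => ψ (φ j)) atTop atTop := hψ.tendsto_atTop.comp hφ.tendsto_atTop
  obtain ⟨j₁, hj₁⟩ := eventually_atTop.1 (hψφ.eventually hLRO)
  have h1 := hj₀ (max j₀ j₁) (max j₀ j₁) (le_max_left _ _) (le_max_left _ _)
  have h2 : σ ^ (2 * k) ≤ (sys (ψ (φ (max j₀ j₁)))).moment β k := hj₁ _ (le_max_right _ _)
  have h3 : σ ≤ ((sys (ψ (φ (max j₀ j₁)))).moment β k) ^ ((1 : ℝ) / (2 * k)) := by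
    calc σ = (σ ^ (2 * k)) ^ ((1 : ℝ) / (2 * k)) := (pow_rpow_one_div_two_mul hσ hk).symm
      _ ≤ _ := Real.rpow_le_rpow (pow_nonneg hσ _) h2 (by positivity)
  have h4 := hbad (φ (max j₀ j₁))
  simp only [not_le] at h4
  linarith

/-- The `k = 1` spelling: eventual long-range order `σ² ≤ N_j⁻²⟨O²⟩_j(0)` (`σ ≥ 0`) forces, for every
`B > 0`, `ε > 0`, eventually `σ ≤ N_j⁻¹⟨O⟩_j(B) + ε` — no hypothesis i).
[cite: KomaTasaki1993, Theorem 2.1 (2.13) with k = 1, (2.12)] -/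
theorem le_magnetisation_add_of_eventually_moment_one (sys : (j : ℕ) → Z2System (Ns j) hb ob r (ns j))
    (hob : 0 ≤ ob) {β : ℝ} (hβ : 0 < β) (hN : Tendsto Ns atTop atTop) {c : ℝ}
    (hdim : ∀ j, Real.log (Fintype.card (ns j)) ≤ c * Ns j) {σ : ℝ} (hσ : 0 ≤ σ)
    (hLRO : ∀ᶠ j in atTop, σ ^ 2 ≤ (sys j).moment β 1) {B : ℝ} (hB : 0 < B) {ε : ℝ} (hε : 0 < ε) :
    ∀ᶠ j in atTop, σ ≤ (sys j).magnetisation β B + ε :=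
  le_magnetisation_add_of_eventually_moment sys hob hβ hN hdim le_rfl hσ (by simpa using hLRO) hB hε

/-- The same floor along ANY side sequence `Ls → ∞` of a family of systems indexed by the volume
parameter `L` (e.g. the tori of side `L`): if the symmetric moments satisfy `σ² ≤ moment` for all large
`L`, then for every `B > 0`, `ε > 0` and every `Ls → ∞`, eventually in `j`,
`σ ≤ N_{Ls j}⁻¹⟨O⟩_{Ls j}(B) + ε`. [cite: KomaTasaki1993, Theorem 2.1 (2.13) with k = 1] -/
theorem le_magnetisation_add_of_eventually_moment_one_comp {NL : ℕ → ℕ} {nL : ℕ → Type v}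
    [∀ L, Fintype (nL L)] [∀ L, DecidableEq (nL L)] [∀ L, Nonempty (nL L)]
    (sysL : (L : ℕ) → Z2System (NL L) hb ob r (nL L)) (hob : 0 ≤ ob) {β : ℝ} (hβ : 0 < β)
    (hNL : Tendsto NL atTop atTop) {c : ℝ} (hdim : ∀ L, Real.log (Fintype.card (nL L)) ≤ c * NL L)
    {σ : ℝ} (hσ : 0 ≤ σ) (hLRO : ∀ᶠ L in atTop, σ ^ 2 ≤ (sysL L).moment β 1)
    {Ls : ℕ → ℕ} (hLs : Tendsto Ls atTop atTop) {B : ℝ} (hB : 0 < B) {ε : ℝ} (hε : 0 < ε) :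
    ∀ᶠ j in atTop, σ ≤ (sysL (Ls j)).magnetisation β B + ε :=
  le_magnetisation_add_of_eventually_moment_one (fun j => sysL (Ls j)) hob hβ (hNL.comp hLs)
    (fun j => hdim (Ls j)) hσ (hLs.eventually hLRO) hB hε

/-! ### §4. The `U(1)` factor `√2` without hypothesis i) -/

/-- **`U(1)` SYSTEMS: EVENTUAL LONG-RANGE ORDER FORCES `√2 σ ≤ N_j⁻¹⟨O⟩_j(B) + ε'` ALONG THE FULL SEQUENCE,
WITHOUT HYPOTHESIS i).**  Setting of the tree's `kt93_corollary_2_2_u1` (KT93 Corollary 2.2 with the Remark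
after Theorem 6.1 for an `SO(2) = U(1)` symmetry): `ℤ₂` systems `sys j` with uniform constants, a second
Hermitian component `O^{(2)}_j` (`‖O^{(2)}_j‖ ≤ ō N_j`) and a conserved generator `C_j` (`[H_j, C_j] = 0`) with
`[C_j, O^{(2)}_j] = ε O_j`, `[C_j, O_j] = -ε O^{(2)}_j` (`ε ≠ 0` fixed), `‖[O^{(2)}_j, O_j]‖ ≤ κ ō² N_j`
(`κ ≥ 0`); `N_j → ∞`, `log dim 𝓗_j ≤ c N_j`, `β > 0`.  If eventually `σ² ≤ N_j⁻²⟨O_j²⟩_j(0)` (`σ ≥ 0`), then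
for every `B > 0`, `ε' > 0`, eventually `√2 σ ≤ N_j⁻¹⟨O_j⟩_j(B) + ε'` (same contradiction argument as
`le_magnetisation_add_of_eventually_moment`, with `kt93_corollary_2_2_u1` along the extracted subsequence).
[cite: KomaTasaki1993, Corollary 2.2 (2.18) with Remark after Theorem 6.1 (SO(2) = U(1): factor √2); Theorem 2.1 (2.13); p. 196] -/
theorem le_sqrt_two_mul_magnetisation_add_of_eventually_moment_one_u1 {κ : ℝ}
    (sys : (j : ℕ) → Z2System (Ns j) hb ob r (ns j)) (O₂ C : (j : ℕ) → Matrix (ns j) (ns j) ℂ) {ε : ℂ}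
    (hε : ε ≠ 0) (hκ0 : 0 ≤ κ) (hO₂h : ∀ j, (O₂ j).IsHermitian) (hC : ∀ j, Commute (sys j).hamiltonian (C j))
    (hrot₁ : ∀ j, C j * O₂ j - O₂ j * C j = ε • (sys j).order)
    (hrot₂ : ∀ j, C j * (sys j).order - (sys j).order * C j = -(ε • O₂ j))
    (hO₂ : ∀ j, ‖O₂ j‖ ≤ ob * Ns j)
    (hκ : ∀ j, ‖O₂ j * (sys j).order - (sys j).order * O₂ j‖ ≤ κ * ob ^ 2 * Ns j)
    (hob : 0 ≤ ob) {β : ℝ} (hβ : 0 < β) (hN : Tendsto Ns atTop atTop) {c : ℝ}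
    (hdim : ∀ j, Real.log (Fintype.card (ns j)) ≤ c * Ns j) {σ : ℝ} (hσ : 0 ≤ σ)
    (hLRO : ∀ᶠ j in atTop, σ ^ 2 ≤ (sys j).moment β 1) {B : ℝ} (hB : 0 < B) {ε' : ℝ} (hε' : 0 < ε') :
    ∀ᶠ j in atTop, Real.sqrt 2 * σ ≤ (sys j).magnetisation β B + ε' := by
  by_contra hcon
  rw [not_eventually] at hcon
  obtain ⟨ψ, hψ, hbad⟩ := extraction_of_frequently_atTop hcon
  obtain ⟨φ, hφ, hlim⟩ := exists_strictMono_forall_tendsto_freeEnergy (fun i => sys (ψ i)) hob hβ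
    (fun i => hdim (ψ i))
  have hψφ : Tendsto (fun j => ψ (φ j)) atTop atTop := hψ.tendsto_atTop.comp hφ.tendsto_atTop
  have hkt := kt93_corollary_2_2_u1 (fun j => sys (ψ (φ j))) (fun j => O₂ (ψ (φ j))) (fun j => C (ψ (φ j)))
    hε hκ0 (fun _ => hO₂h _) (fun _ => hC _) (fun _ => hrot₁ _) (fun _ => hrot₂ _) (fun _ => hO₂ _)
    (fun _ => hκ _) hβ (hN.comp hψφ) hlim B hB (ε' / 2) (half_pos hε')
  obtain ⟨j₀, hj₀⟩ := hkt
  obtain ⟨j₁, hj₁⟩ := eventually_atTop.1 (hψφ.eventually hLRO)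
  have h1 := hj₀ (max j₀ j₁) (max j₀ j₁) (le_max_left _ _) (le_max_left _ _)
  have h2 : σ ^ 2 ≤ (sys (ψ (φ (max j₀ j₁)))).moment β 1 := hj₁ _ (le_max_right _ _)
  have h3 : σ ≤ Real.sqrt ((sys (ψ (φ (max j₀ j₁)))).moment β 1) := by
    rw [← Real.sqrt_sq hσ]
    exact Real.sqrt_le_sqrt h2
  have h4 := hbad (φ (max j₀ j₁))
  simp only [not_le] at h4
  have h5 : Real.sqrt 2 * σ ≤ Real.sqrt 2 * Real.sqrt ((sys (ψ (φ (max j₀ j₁)))).moment β 1) :=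
    mul_le_mul_of_nonneg_left h3 (Real.sqrt_nonneg 2)
  linarith

/-- The `U(1)` floor along any side sequence `Ls → ∞` of a volume-indexed family (e.g. the tori of side `L`):
eventual LRO `σ² ≤ moment` in `L` ⟹ for every `B > 0`, `ε' > 0`, eventually in `j`,
`√2 σ ≤ N_{Ls j}⁻¹⟨O⟩_{Ls j}(B) + ε'`. [cite: KomaTasaki1993, Corollary 2.2 (2.18) with Remark after Theorem 6.1] -/
theorem le_sqrt_two_mul_magnetisation_add_of_eventually_moment_one_u1_comp {κ : ℝ} {NL : ℕ → ℕ}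
    {nL : ℕ → Type v} [∀ L, Fintype (nL L)] [∀ L, DecidableEq (nL L)] [∀ L, Nonempty (nL L)]
    (sysL : (L : ℕ) → Z2System (NL L) hb ob r (nL L)) (O₂ C : (L : ℕ) → Matrix (nL L) (nL L) ℂ) {ε : ℂ}
    (hε : ε ≠ 0) (hκ0 : 0 ≤ κ) (hO₂h : ∀ L, (O₂ L).IsHermitian) (hC : ∀ L, Commute (sysL L).hamiltonian (C L))
    (hrot₁ : ∀ L, C L * O₂ L - O₂ L * C L = ε • (sysL L).order)
    (hrot₂ : ∀ L, C L * (sysL L).order - (sysL L).order * C L = -(ε • O₂ L))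
    (hO₂ : ∀ L, ‖O₂ L‖ ≤ ob * NL L)
    (hκ : ∀ L, ‖O₂ L * (sysL L).order - (sysL L).order * O₂ L‖ ≤ κ * ob ^ 2 * NL L)
    (hob : 0 ≤ ob) {β : ℝ} (hβ : 0 < β) (hNL : Tendsto NL atTop atTop) {c : ℝ}
    (hdim : ∀ L, Real.log (Fintype.card (nL L)) ≤ c * NL L) {σ : ℝ} (hσ : 0 ≤ σ)
    (hLRO : ∀ᶠ L in atTop, σ ^ 2 ≤ (sysL L).moment β 1) {Ls : ℕ → ℕ} (hLs : Tendsto Ls atTop atTop)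
    {B : ℝ} (hB : 0 < B) {ε' : ℝ} (hε' : 0 < ε') :
    ∀ᶠ j in atTop, Real.sqrt 2 * σ ≤ (sysL (Ls j)).magnetisation β B + ε' :=
  le_sqrt_two_mul_magnetisation_add_of_eventually_moment_one_u1 (fun j => sysL (Ls j)) (fun j => O₂ (Ls j))
    (fun j => C (Ls j)) hε hκ0 (fun _ => hO₂h _) (fun _ => hC _) (fun _ => hrot₁ _) (fun _ => hrot₂ _)
    (fun _ => hO₂ _) (fun _ => hκ _) hob hβ (hNL.comp hLs) (fun j => hdim (Ls j)) hσ (hLs.eventually hLRO) hB hε'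

end Sequence

end Z2System

/-! ### §5. The `SU(2)` factor `√3` (KT93 Corollary 2.2) without hypothesis i) -/

namespace SU2System

variable {hb ob : ℝ} {r : ℕ} {Ns : ℕ → ℕ} {ns : ℕ → Type v} [∀ j, Fintype (ns j)] [∀ j, DecidableEq (ns j)]
  [∀ j, Nonempty (ns j)]

/-- **`SU(2)` SYSTEMS (KT93 COROLLARY 2.2 BY NAME): EVENTUAL LONG-RANGE ORDER FORCES
`√3 σ ≤ N_j⁻¹⟨O^{(1)}_j⟩_j(B) + ε` ALONG THE FULL SEQUENCE, WITHOUT HYPOTHESIS i).**  For a sequence of KT93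
`SU(2)` systems `sys j` (hypotheses ii)–vi): uniform `h̄, ō, r`, three order components `O^{(i)}` rotated by
conserved `su(2)` generators `X^{(j)}`), `N_j → ∞`, `log dim 𝓗_j ≤ c N_j`, `β > 0`, `ō ≥ 0`: if eventually
`σ² ≤ N_j⁻²⟨(O^{(1)}_j)²⟩_j(0)` (`σ ≥ 0`), then for every `B > 0` and `ε > 0`, eventually
`√3 σ ≤ N_j⁻¹⟨O^{(1)}_j⟩_j(B) + ε`; i.e. `liminf_Λ m_Λ(B) ≥ √3 σ` for every `B > 0` and `m_s ≥ √3 σ` (2.18) along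
every convergent choice of the limits (2.11) — the contradiction argument of §3/§4 with the tree's
`kt93_corollary_2_2_holds` along a subsequence with convergent free energies
(`Z2System.exists_strictMono_forall_tendsto_freeEnergy`).
[cite: KomaTasaki1993, Corollary 2.2 (2.18); Theorem 2.1 (2.13); p. 196 (subsequences)] -/
theorem le_sqrt_three_mul_magnetisation_add_of_eventually_moment_one
    (sys : (j : ℕ) → SU2System (Ns j) hb ob r (ns j)) (hob : 0 ≤ ob) {β : ℝ} (hβ : 0 < β)
    (hN : Tendsto Ns atTop atTop) {c : ℝ} (hdim : ∀ j, Real.log (Fintype.card (ns j)) ≤ c * Ns j) {σ : ℝ}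
    (hσ : 0 ≤ σ) (hLRO : ∀ᶠ j in atTop, σ ^ 2 ≤ (sys j).toZ2System.moment β 1) {B : ℝ} (hB : 0 < B) {ε : ℝ}
    (hε : 0 < ε) :
    ∀ᶠ j in atTop, Real.sqrt 3 * σ ≤ (sys j).toZ2System.magnetisation β B + ε := by
  by_contra hcon
  rw [not_eventually] at hcon
  obtain ⟨ψ, hψ, hbad⟩ := extraction_of_frequently_atTop hcon
  obtain ⟨φ, hφ, hlim⟩ := Z2System.exists_strictMono_forall_tendsto_freeEnergy
    (fun i => (sys (ψ i)).toZ2System) hob hβ (fun i => hdim (ψ i))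
  have hψφ : Tendsto (fun j => ψ (φ j)) atTop atTop := hψ.tendsto_atTop.comp hφ.tendsto_atTop
  obtain ⟨j₀, hj₀⟩ := kt93_corollary_2_2_holds hb ob r (fun j => Ns (ψ (φ j))) (fun j => ns (ψ (φ j)))
    (fun j => sys (ψ (φ j))) β hβ (hN.comp hψφ) hlim B hB (ε / 2) (half_pos hε)
  obtain ⟨j₁, hj₁⟩ := eventually_atTop.1 (hψφ.eventually hLRO)
  have h1 := hj₀ (max j₀ j₁) (max j₀ j₁) (le_max_left _ _) (le_max_left _ _)
  have h2 : σ ^ 2 ≤ (sys (ψ (φ (max j₀ j₁)))).toZ2System.moment β 1 := hj₁ _ (le_max_right _ _)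
  have h3 : σ ≤ Real.sqrt ((sys (ψ (φ (max j₀ j₁)))).toZ2System.moment β 1) := by
    rw [← Real.sqrt_sq hσ]
    exact Real.sqrt_le_sqrt h2
  have h4 := hbad (φ (max j₀ j₁))
  simp only [not_le] at h4
  have h5 : Real.sqrt 3 * σ ≤ Real.sqrt 3 * Real.sqrt ((sys (ψ (φ (max j₀ j₁)))).toZ2System.moment β 1) :=
    mul_le_mul_of_nonneg_left h3 (Real.sqrt_nonneg 3)
  linarith

/-- The `SU(2)` floor along any side sequence `Ls → ∞` of a volume-indexed family (e.g. the tori of side `L`):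
eventual LRO `σ² ≤ moment` in `L` ⟹ for every `B > 0`, `ε > 0`, eventually in `j`,
`√3 σ ≤ N_{Ls j}⁻¹⟨O^{(1)}⟩_{Ls j}(B) + ε`. [cite: KomaTasaki1993, Corollary 2.2 (2.18)] -/
theorem le_sqrt_three_mul_magnetisation_add_of_eventually_moment_one_comp {NL : ℕ → ℕ}
    {nL : ℕ → Type v} [∀ L, Fintype (nL L)] [∀ L, DecidableEq (nL L)] [∀ L, Nonempty (nL L)]
    (sysL : (L : ℕ) → SU2System (NL L) hb ob r (nL L)) (hob : 0 ≤ ob) {β : ℝ} (hβ : 0 < β)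
    (hNL : Tendsto NL atTop atTop) {c : ℝ} (hdim : ∀ L, Real.log (Fintype.card (nL L)) ≤ c * NL L) {σ : ℝ}
    (hσ : 0 ≤ σ) (hLRO : ∀ᶠ L in atTop, σ ^ 2 ≤ (sysL L).toZ2System.moment β 1) {Ls : ℕ → ℕ}
    (hLs : Tendsto Ls atTop atTop) {B : ℝ} (hB : 0 < B) {ε : ℝ} (hε : 0 < ε) :
    ∀ᶠ j in atTop, Real.sqrt 3 * σ ≤ (sysL (Ls j)).toZ2System.magnetisation β B + ε :=
  le_sqrt_three_mul_magnetisation_add_of_eventually_moment_one (fun j => sysL (Ls j)) hob hβ (hNL.comp hLs)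
    (fun j => hdim (Ls j)) hσ (hLs.eventually hLRO) hB hε

end SU2System

end Literature.MathematicalPhysics.QuantumLattice.KomaTasaki
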